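import Literature.NumberTheory.GaloisRepresentations.LubinTateColemanCoordBaseChangeTwo
import Literature.NumberTheory.GaloisRepresentations.LubinTateColemanCoordCoinvariantTwistTwo
import Literature.NumberTheory.GaloisRepresentations.LubinTateColemanUnitsImageModuleTwo
import Literature.NumberTheory.GaloisRepresentations.LocalFieldDyadicCharacterKernel
import Literature.NumberTheory.GaloisRepresentations.PotentialDiagonalizabilityCriteriaProofs
import Literature.RingTheory.PowerSeries.WeierstrassDegreeOne
import HarnessLib

/-!
# The twist scalars `t_v = φ_ε(σ_v 1) ∈ Λ = 𝒪_F⟦X⟧⟦T⟧` at `q = 2`: `t_v` is a unit with `X`-constant coefficients, `[T¹]t_v` is a unit for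
# `v ∈ ±γ·U_3`, and the «twisted augmentation elements» `t_v·C g − N` — a PRIME of `Λ` when `[T¹]` is a unit, and a prime PAIR from two
# Galois elements with different unramified exponents (de Shalit II §4.12: the auxiliary ideals `𝔞₁, 𝔞₂`)

De Shalit, *Iwasawa theory of elliptic curves with complex multiplication* (1987), Ch. II §4.12 (29)–(33): the elliptic units `e(𝔞)` have
Coleman images `(σ_𝔞 − N𝔞)·μ`, and to divide by `σ_{𝔞₁} − N𝔞₁` one needs auxiliary ideals with `σ_{𝔞₁} − N𝔞₁`, `σ_{𝔞₂} − N𝔞₂` RELATIVELY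
PRIME in `Λ`; III §1.4 (5), Lemma 1.10 (17): the comparison of the elliptic-unit module with Rubin's closure is «up to the ideal generated by
the `σ_𝔠 − N𝔠`», which has height two as soon as it contains such a pair.  In the tree's series currency at `q = 2` a Galois element `σ̃` of
the local two-variable tower acts on the `ε`-coinvariants `(N_Σ)_ε` of the Coleman trace module by the scalar `t_{χ_π(σ̃)}·C(g_σ̃)`
(`map_indexTraceₗ_galOpₗ`; `t_v = colemanDeltaCoinvFun … ε (unitTwistₗ … v (ofPS 1))`, `g_σ̃ ∈ 𝒪_F⟦X⟧` an Amice element of `σ̃|_{E_∞}`: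
`g ≡ (1+X)^{a_m} mod ((1+X)^{2^m} − 1)`).  THIS file proves, for the base `ι = intBase F` (`Λ = 𝒪_F⟦X⟧⟦T⟧`, OUTER variable `T`):

* §1 `isUnit_twistScalar` (`t_v t_{v⁻¹} = 1`), `isUnit_constantCoeff_twistScalar`;
* §2 ★ `constantCoeff_twistScalar_eq_C` / `map_residue_constantCoeff_twistScalar` — the `T`-constant term of `t_v` is an `X`-CONSTANT unit
  (base change `LubinTateColemanCoordBaseChangeTwo` from the one-variable base), so it reduces to `1` in `k⟦X⟧` (`k = 𝔽₂`);
* §3 ★ `isUnit_coeff_one_twistScalar_of_sq` — for `v = ±γ·s²` (`s ∈ 𝒪_F^×`; every `v ≡ γ (mod π³)` is of this form, `U_3 ⊆ (𝒪_F^×)²`):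
  `[T¹]t_v = ±[T⁰]t_s·([T⁰]t_s + 2[T¹]t_s)` is a UNIT (`t_γ = 1 + T`, `t_{vv'} = t_v t_{v'}`);
* §4 ★★ `prime_twistScalar_mul_C_sub_natCast` — **`f_v := t_v·C g − N` is PRIME in `Λ`** when `[T¹]t_v` is a unit, `g(0) = 1` and `N` is odd
  (`Literature.RingTheory.PowerSeries.prime_of_isUnit_coeff_one`: residual order one in `T` over the complete local domain `𝒪_F⟦X⟧`);
* §5 ★★ `not_dvd_twistScalar_mul_C_sub_natCast` — **`f_{v₁} ∤ f_{v₂}`** as soon as `X(X+2) ∣ g₁ − 1` (the Galois element of `f₁` acts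
  TRIVIALLY on the first unramified `2`-layer `E_1`) and `X(X+2) ∣ g₂ − (1+X)` (that of `f₂` acts there as the Frobenius), `N₁, N₂` odd:
  under `T ↦ 0`, `𝒪_F → 𝔽₂` the first goes to `ḡ₁ − 1 ∈ (X²)`, the second to `ḡ₂ − 1 ≡ X (mod X²)`.
So `(f_{v₁}, f_{v₂})` is a prime pair of `Λ` (`Λ/(f_{v₁}, f_{v₂})` pseudo-null) — the relative primality of de Shalit's auxiliary pair, with
NO condition on the norms beyond parity and none on `χ_π` of the second element.  Everything PROVED (0 sorry), no definitions, no named facts.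

## References
* [deShalit1987] E. de Shalit, *Iwasawa theory of elliptic curves with complex multiplication* (1987), Ch. I §3.1, §3.7; Ch. II §4.12 (29)–(33);
  Ch. III §1.4 (5), Lemma 1.10 (17).
* [Washington1997] L. C. Washington, *Introduction to Cyclotomic Fields*, 2nd ed. (1997), §7.1 Thm. 7.3, §13.2.
* [Serre1973CourseArithmetic] J.-P. Serre, *A Course in Arithmetic* (1973), Ch. II §3.3 (`(1 + 4ℤ₂) = γ^{ℤ₂}`, `1 + 8ℤ₂ = (ℤ₂^×)²`).
-/

noncomputable section

namespace Literature.NumberTheory.GaloisRepresentations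

section TwistScalarDegreeOne

open GaloisRepresentations.IsNonarchimedeanLocalField LubinTate ValuativeRel
open Literature.RingTheory.PowerSeries (maxEval)

variable {F : Type} [Field F] [ValuativeRel F] [TopologicalSpace F] [IsNonarchimedeanLocalField F]

attribute [local instance] ltNormUniformSpace ltNormIsUniformAddGroup rk1 nF nE fintypeResidueField

variable {π : 𝒪[F]} (hπ : (valuation F).IsUniformizer (π : F)) (hq : residueFieldCard F = 2)
variable [IsAdicComplete (Ideal.span {intBase F (LTCoeff.of F π)}) (PowerSeries 𝒪[F])]
variable (u : (LTCoeff F)ˣ) (hu : LTCoeff.of F π = residueFieldCard F * u) (γ w : 𝒪[F]ˣ) (hγ : (γ : 𝒪[F]) = 1 + π ^ 2 * w)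
variable (ε : PowerSeries (PowerSeries 𝒪[F])) (hε : ε * ε = 1)

/-! ### §1. `t_v` is a unit of `Λ` -/

include hε in
/-- **`t_v · t_{v⁻¹} = 1`**: the twist scalars are units of `Λ = 𝒪_F⟦X⟧⟦T⟧`. [cite: deShalit1987, Ch. I §3.1] -/
theorem isUnit_twistScalar (v : 𝒪[F]ˣ) :
    IsUnit (colemanDeltaCoinvFun hπ hq (intBase F) u hu γ (eq_zero_of_C_pi_mul_eq_zero_integer hπ) w hγ ε
      (unitTwistₗ hπ hq (intBase F) u hu γ v (TActModule.ofPS _ _ 1))) := by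
  refine IsUnit.of_mul_eq_one (colemanDeltaCoinvFun hπ hq (intBase F) u hu γ (eq_zero_of_C_pi_mul_eq_zero_integer hπ) w hγ ε
      (unitTwistₗ hπ hq (intBase F) u hu γ v⁻¹ (TActModule.ofPS _ _ 1))) ?_
  rw [← colemanDeltaCoinvFun_unitTwistₗ_mul_one hπ hq (intBase F) u hu γ _ w hγ ε hε, mul_inv_cancel,
    colemanDeltaCoinvFun_unitTwistₗ_one_one]

include hε in
/-- `[T⁰]t_v` is a unit of `𝒪_F⟦X⟧`. [cite: deShalit1987, Ch. I §3.1] -/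
theorem isUnit_constantCoeff_twistScalar (v : 𝒪[F]ˣ) :
    IsUnit (PowerSeries.constantCoeff (colemanDeltaCoinvFun hπ hq (intBase F) u hu γ (eq_zero_of_C_pi_mul_eq_zero_integer hπ) w hγ ε
      (unitTwistₗ hπ hq (intBase F) u hu γ v (TActModule.ofPS _ _ 1)))) :=
  (isUnit_twistScalar hπ hq u hu γ w hγ ε hε v).map _

/-! ### §2. The `T`-constant term of `t_v` is an `X`-constant unit, `≡ 1 (mod π)` -/

omit [IsAdicComplete (Ideal.span {intBase F (LTCoeff.of F π)}) (PowerSeries 𝒪[F])] in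
include hπ in
/-- `𝒪_F` (discrete copy `LTCoeff F`) is a regular base: `π·x = 0 ⟹ x = 0`. [cite: deShalit1987, Ch. I §3.1] -/
private theorem hreg_id (x : LTCoeff F) (h : (RingHom.id (LTCoeff F)) (LTCoeff.of F π) * x = 0) : x = 0 :=
  (isLTRing_LTCoeff hπ).eq_zero_of_mul_eq_zero _ h

omit [IsAdicComplete (Ideal.span {intBase F (LTCoeff.of F π)}) (PowerSeries 𝒪[F])] in
include hε in
/-- In the domain `Λ`, `ε² = 1` forces `ε = ±1` (the two characters of `Δ = {±1}`). [cite: deShalit1987, Ch. I §3.1] -/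
private theorem eq_one_or_eq_neg_one_of_mul_self : ε = 1 ∨ ε = -1 := mul_self_eq_one_iff.mp hε

include hε in
/-- ★ **`[T⁰]t_v = C a` for a unit `a ∈ 𝒪_F`**: the twist scalars over the two-variable base `𝒪_F⟦X⟧` are the images under `map C` of the
one-variable twist scalars (`colemanDeltaCoinvFun_unitTwistₗ_one_map`), so their `T`-coefficients are CONSTANT in `X`.
[cite: deShalit1987, Ch. I §3.1, §3.7] -/
theorem exists_constantCoeff_twistScalar_eq_C (v : 𝒪[F]ˣ) :
    ∃ a : 𝒪[F], IsUnit a ∧ PowerSeries.constantCoeff (colemanDeltaCoinvFun hπ hq (intBase F) u hu γ (eq_zero_of_C_pi_mul_eq_zero_integer hπ) w hγ ε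
      (unitTwistₗ hπ hq (intBase F) u hu γ v (TActModule.ofPS _ _ 1))) = PowerSeries.C a := by
  haveI : IsAdicComplete (Ideal.span {(RingHom.id (LTCoeff F)) (LTCoeff.of F π)}) (LTCoeff F) := by
    rw [RingHom.id_apply]; exact isAdicComplete_LTCoeff hπ
  have hκ : (intBase F).comp (RingHom.id (LTCoeff F)) = intBase F := RingHom.comp_id _
  -- `ε = map intBase ε₀` with `ε₀ = ±1`
  obtain ⟨ε₀, hε₀⟩ : ∃ ε₀ : PowerSeries (LTCoeff F), ε = PowerSeries.map (intBase F) ε₀ := by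
    rcases eq_one_or_eq_neg_one_of_mul_self ε hε with h | h
    · exact ⟨1, by rw [h, map_one]⟩
    · exact ⟨-1, by rw [h, map_neg, map_one]⟩
  have hunit := isUnit_constantCoeff_twistScalar hπ hq u hu γ w hγ ε hε v
  subst hε₀
  have e := colemanDeltaCoinvFun_unitTwistₗ_one_map hπ hq (RingHom.id (LTCoeff F)) (intBase F) (intBase F) hκ u hu γ (hreg_id hπ)
    (eq_zero_of_C_pi_mul_eq_zero_integer hπ) w hγ ε₀ v
  rw [e] at hunit ⊢
  set y := PowerSeries.constantCoeff (colemanDeltaCoinvFun hπ hq (RingHom.id (LTCoeff F)) u hu γ (hreg_id hπ) w hγ ε₀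
      (unitTwistₗ hπ hq (RingHom.id (LTCoeff F)) u hu γ v (TActModule.ofPS _ _ 1))) with hy
  have hmap : PowerSeries.constantCoeff (PowerSeries.map (intBase F) (colemanDeltaCoinvFun hπ hq (RingHom.id (LTCoeff F)) u hu γ (hreg_id hπ) w hγ ε₀
      (unitTwistₗ hπ hq (RingHom.id (LTCoeff F)) u hu γ v (TActModule.ofPS _ _ 1)))) = PowerSeries.C ((LTCoeff.of F).symm y) := by
    rw [← PowerSeries.coeff_zero_eq_constantCoeff_apply, PowerSeries.coeff_map, PowerSeries.coeff_zero_eq_constantCoeff_apply]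
    rfl
  refine ⟨(LTCoeff.of F).symm y, ?_, hmap⟩
  rw [hmap] at hunit
  have h2 := hunit.map (PowerSeries.constantCoeff (R := 𝒪[F]))
  rwa [PowerSeries.constantCoeff_C] at h2

include hε in
/-- ★ **`[T⁰]t_v ≡ 1` in `k⟦X⟧`** (`k = 𝒪_F/π = 𝔽₂`: the `X`-constant unit `a` reduces to the only unit `1` of `𝔽₂`).
[cite: deShalit1987, Ch. I §3.1, §3.7] -/
theorem map_residue_constantCoeff_twistScalar (v : 𝒪[F]ˣ) :
    PowerSeries.map (IsLocalRing.residue 𝒪[F]) (PowerSeries.constantCoeff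
      (colemanDeltaCoinvFun hπ hq (intBase F) u hu γ (eq_zero_of_C_pi_mul_eq_zero_integer hπ) w hγ ε
        (unitTwistₗ hπ hq (intBase F) u hu γ v (TActModule.ofPS _ _ 1)))) = 1 := by
  obtain ⟨a, ha, e⟩ := exists_constantCoeff_twistScalar_eq_C hπ hq u hu γ w hγ ε hε v
  rw [e, PowerSeries.map_C]
  have h1 : IsLocalRing.residue 𝒪[F] a = 1 := by
    have hd := uniformizer_dvd_sub_one_of_isUnit hπ hq ha
    rw [uniformizer_dvd_iff_mem_maximalIdeal hπ, ← IsLocalRing.residue_eq_zero_iff, map_sub, map_one, sub_eq_zero] at hd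
    exact hd
  rw [h1, map_one]

/-! ### §3. `[T¹]t_v` is a unit for `v = ±γ·s²` -/

include hε in
/-- ★ **`[T¹]t_{γs²}` is a unit**: `t_{γs²} = (1+T)·t_s²`, so `[T¹] = [T⁰]t_s·([T⁰]t_s + 2[T¹]t_s)` with `[T⁰]t_s` a unit and `2 ∈ 𝔪`.
(Every `v ≡ γ (mod π³)` is `γ s²`: `U_3 ⊆ (𝒪_F^×)²`.) [cite: deShalit1987, Ch. I §3.1; Ch. II §4.12 (32)] [cite: Serre1973CourseArithmetic, Ch. II §3.3] -/
theorem isUnit_coeff_one_twistScalar_gen_mul_sq (s : 𝒪[F]ˣ) :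
    IsUnit (PowerSeries.coeff 1 (colemanDeltaCoinvFun hπ hq (intBase F) u hu γ (eq_zero_of_C_pi_mul_eq_zero_integer hπ) w hγ ε
      (unitTwistₗ hπ hq (intBase F) u hu γ (γ * (s * s)) (TActModule.ofPS _ _ 1)))) := by
  set ts := colemanDeltaCoinvFun hπ hq (intBase F) u hu γ (eq_zero_of_C_pi_mul_eq_zero_integer hπ) w hγ ε
      (unitTwistₗ hπ hq (intBase F) u hu γ s (TActModule.ofPS _ _ 1)) with hts
  have hc1 : PowerSeries.coeff 1 (ts * ts) = 2 * PowerSeries.constantCoeff ts * PowerSeries.coeff 1 ts := by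
    rw [PowerSeries.coeff_mul, Finset.Nat.sum_antidiagonal_eq_sum_range_succ_mk, Finset.sum_range_succ, Finset.sum_range_succ,
      Finset.sum_range_zero]
    simp only [tsub_zero, tsub_self, PowerSeries.coeff_zero_eq_constantCoeff_apply]
    ring
  have hc0 : PowerSeries.coeff 0 (ts * ts) = PowerSeries.constantCoeff ts * PowerSeries.constantCoeff ts := by
    rw [PowerSeries.coeff_zero_eq_constantCoeff_apply, map_mul]
  rw [colemanDeltaCoinvFun_unitTwistₗ_mul_one hπ hq (intBase F) u hu γ _ w hγ ε hε, colemanDeltaCoinvFun_unitTwistₗ_self_one,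
    colemanDeltaCoinvFun_unitTwistₗ_mul_one hπ hq (intBase F) u hu γ _ w hγ ε hε, ← hts, add_mul, one_mul, map_add,
    PowerSeries.coeff_succ_X_mul, hc1, hc0]
  have h0 : IsUnit (PowerSeries.constantCoeff ts) := isUnit_constantCoeff_twistScalar hπ hq u hu γ w hγ ε hε s
  -- `2c₀c₁ + c₀c₀ = c₀ (c₀ + 2 c₁)`
  have e : 2 * PowerSeries.constantCoeff ts * PowerSeries.coeff 1 ts + PowerSeries.constantCoeff ts * PowerSeries.constantCoeff ts =
      PowerSeries.constantCoeff ts * (PowerSeries.constantCoeff ts + 2 * PowerSeries.coeff 1 ts) := by ring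
  rw [e]
  refine h0.mul ?_
  -- a unit plus an element of `𝔪` is a unit (`2 ∈ 𝔪_{𝒪⟦X⟧}`)
  by_contra hnu
  have h2 : (2 : PowerSeries 𝒪[F]) * PowerSeries.coeff 1 ts ∈ IsLocalRing.maximalIdeal (PowerSeries 𝒪[F]) := by
    refine Ideal.mul_mem_right _ _ ((IsLocalRing.mem_maximalIdeal _).mpr fun h2u ↦ ?_)
    have h2u' : IsUnit (PowerSeries.constantCoeff (2 : PowerSeries 𝒪[F])) := h2u.map _
    rw [map_ofNat] at h2u'
    obtain ⟨t, ht⟩ : π ∣ (2 : 𝒪[F]) := by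
      have h := congrArg (LTCoeff.of F).symm (two_eq_of_mul_inv (π := π) hq u hu)
      rw [map_ofNat, map_mul, RingEquiv.symm_apply_apply] at h
      exact ⟨_, h⟩
    rw [ht] at h2u'
    exact not_isUnit_uniformizer hπ (isUnit_of_mul_isUnit_left h2u')
  have hsum : PowerSeries.constantCoeff ts + 2 * PowerSeries.coeff 1 ts ∈ IsLocalRing.maximalIdeal (PowerSeries 𝒪[F]) :=
    (IsLocalRing.mem_maximalIdeal _).mpr hnu
  have := Ideal.sub_mem _ hsum h2
  rw [add_sub_cancel_right] at this
  exact (IsLocalRing.mem_maximalIdeal _).mp this h0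

include hε in
/-- The same with a sign: `[T¹]t_{−γs²} = ε·[T¹]t_{γs²}` is a unit (`ε = ±1`). [cite: deShalit1987, Ch. I §3.1; Ch. II §4.12 (32)] -/
theorem isUnit_coeff_one_twistScalar_neg_gen_mul_sq (s : 𝒪[F]ˣ) :
    IsUnit (PowerSeries.coeff 1 (colemanDeltaCoinvFun hπ hq (intBase F) u hu γ (eq_zero_of_C_pi_mul_eq_zero_integer hπ) w hγ ε
      (unitTwistₗ hπ hq (intBase F) u hu γ (-(γ * (s * s))) (TActModule.ofPS _ _ 1)))) := by
  rw [← neg_one_mul, colemanDeltaCoinvFun_unitTwistₗ_mul_one hπ hq (intBase F) u hu γ _ w hγ ε hε,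
    colemanDeltaCoinvFun_unitTwistₗ_neg_one_one hπ hq (intBase F) u hu γ _ w hγ ε hε]
  rcases eq_one_or_eq_neg_one_of_mul_self ε hε with h | h <;> subst h
  · rw [one_mul]; exact isUnit_coeff_one_twistScalar_gen_mul_sq hπ hq u hu γ w hγ 1 hε s
  · rw [neg_one_mul, map_neg, IsUnit.neg_iff]; exact isUnit_coeff_one_twistScalar_gen_mul_sq hπ hq u hu γ w hγ (-1) hε s

/-! ### §4. `f_v = t_v·C g − N` is prime when `[T¹]t_v` is a unit -/

omit [IsAdicComplete (Ideal.span {intBase F (LTCoeff.of F π)}) (PowerSeries 𝒪[F])] in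
include hq hu in
/-- `π ∣ 2` (`π = 2u`). [cite: deShalit1987, Ch. I §3.13] -/
private theorem pi_dvd_two : π ∣ (2 : 𝒪[F]) := by
  have h := congrArg (LTCoeff.of F).symm (two_eq_of_mul_inv (π := π) hq u hu)
  rw [map_ofNat, map_mul, RingEquiv.symm_apply_apply] at h
  exact ⟨_, h⟩

omit [IsAdicComplete (Ideal.span {intBase F (LTCoeff.of F π)}) (PowerSeries 𝒪[F])] in
include hq hu in
/-- `π ∣ n − 1` for odd `n`. [cite: deShalit1987, Ch. I §3.13] -/
private theorem pi_dvd_natCast_sub_one {n : ℕ} (hn : Odd n) : π ∣ ((n : 𝒪[F]) - 1) := by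
  obtain ⟨k, rfl⟩ := hn
  rw [Nat.cast_add, Nat.cast_mul, Nat.cast_ofNat, Nat.cast_one, add_sub_cancel_right]
  exact (pi_dvd_two hq u hu).mul_right _

include hε in
/-- ★★ **`f_v := t_v·C g − N` is PRIME in `Λ = 𝒪_F⟦X⟧⟦T⟧`** whenever `[T¹]t_v` is a unit (e.g. `v = ±γs²`, §3), `g(0) = 1` (any Amice element)
and `N` is odd: `[T⁰]f_v = [T⁰]t_v·g − N` has `X`-constant term `unit − odd ∈ (π)`, so `f_v` has residual order one in `T` over the complete
local domain `𝒪_F⟦X⟧` and `Literature.RingTheory.PowerSeries.prime_of_isUnit_coeff_one` applies.  This is the primality of de Shalit's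
`σ_{𝔞₁} − N𝔞₁` in the two-variable algebra. [cite: deShalit1987, Ch. II §4.12 (32); Ch. III §1.4 (5)] [cite: Washington1997, §7.1 Thm. 7.3] -/
theorem prime_twistScalar_mul_C_sub_natCast {v : 𝒪[F]ˣ}
    (h1 : IsUnit (PowerSeries.coeff 1 (colemanDeltaCoinvFun hπ hq (intBase F) u hu γ (eq_zero_of_C_pi_mul_eq_zero_integer hπ) w hγ ε
      (unitTwistₗ hπ hq (intBase F) u hu γ v (TActModule.ofPS _ _ 1)))))
    {g : PowerSeries 𝒪[F]} (hg : PowerSeries.constantCoeff g = 1) {n : ℕ} (hn : Odd n) :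
    Prime (colemanDeltaCoinvFun hπ hq (intBase F) u hu γ (eq_zero_of_C_pi_mul_eq_zero_integer hπ) w hγ ε
        (unitTwistₗ hπ hq (intBase F) u hu γ v (TActModule.ofPS _ _ 1)) * PowerSeries.C g - (n : PowerSeries (PowerSeries 𝒪[F]))) := by
  haveI : IsAdicComplete (IsLocalRing.maximalIdeal (PowerSeries 𝒪[F])) (PowerSeries 𝒪[F]) := powerSeries_isAdicComplete_maximalIdeal
  set t := colemanDeltaCoinvFun hπ hq (intBase F) u hu γ (eq_zero_of_C_pi_mul_eq_zero_integer hπ) w hγ ε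
      (unitTwistₗ hπ hq (intBase F) u hu γ v (TActModule.ofPS _ _ 1)) with ht
  have hgu : IsUnit g := PowerSeries.isUnit_iff_constantCoeff.mpr (by rw [hg]; exact isUnit_one)
  refine Literature.RingTheory.PowerSeries.prime_of_isUnit_coeff_one ?_ ?_
  · -- `[T⁰] = [T⁰]t·g − n`, a non-unit: its `X`-constant term is `unit − odd ∈ (π)`
    rw [map_sub, map_mul, PowerSeries.constantCoeff_C, map_natCast, IsLocalRing.mem_maximalIdeal, mem_nonunits_iff]
    intro hU
    have hU' := hU.map (PowerSeries.constantCoeff (R := 𝒪[F]))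
    rw [map_sub, map_mul, hg, mul_one, map_natCast] at hU'
    have hc := isUnit_constantCoeff_twistScalar hπ hq u hu γ w hγ ε hε v
    have hdvd : π ∣ PowerSeries.constantCoeff (PowerSeries.constantCoeff t) - (n : 𝒪[F]) := by
      have e : PowerSeries.constantCoeff (PowerSeries.constantCoeff t) - (n : 𝒪[F]) =
          (PowerSeries.constantCoeff (PowerSeries.constantCoeff t) - 1) - ((n : 𝒪[F]) - 1) := by ring
      rw [e]
      exact dvd_sub (uniformizer_dvd_sub_one_of_isUnit hπ hq (hc.map _)) (pi_dvd_natCast_sub_one hq u hu hn)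
    rw [uniformizer_dvd_iff_mem_maximalIdeal hπ] at hdvd
    exact (IsLocalRing.mem_maximalIdeal _).mp hdvd hU'
  · rw [map_sub, PowerSeries.coeff_mul_C, ← map_natCast (PowerSeries.C (R := PowerSeries 𝒪[F])), PowerSeries.coeff_C, if_neg one_ne_zero,
      sub_zero]
    exact h1.mul hgu

/-! ### §5. A prime PAIR: different unramified exponents at the first `2`-layer -/

omit [IsAdicComplete (Ideal.span {intBase F (LTCoeff.of F π)}) (PowerSeries 𝒪[F])] in
include hπ hq hu in
/-- `2 = 0` in the residue field `k = 𝒪_F/π`. [cite: deShalit1987, Ch. I §3.13] -/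
private theorem residue_two_eq_zero : IsLocalRing.residue 𝒪[F] 2 = 0 := by
  rw [IsLocalRing.residue_eq_zero_iff, ← uniformizer_dvd_iff_mem_maximalIdeal hπ]
  exact pi_dvd_two hq u hu

omit [IsAdicComplete (Ideal.span {intBase F (LTCoeff.of F π)}) (PowerSeries 𝒪[F])] in
include hπ hq hu in
/-- An odd natural number is `1` in `k⟦X⟧`. [cite: deShalit1987, Ch. I §3.13] -/
private theorem natCast_residue_powerSeries_eq_one {n : ℕ} (hn : Odd n) :
    (n : PowerSeries (IsLocalRing.ResidueField 𝒪[F])) = 1 := by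
  obtain ⟨k, rfl⟩ := hn
  have h2 : (2 : PowerSeries (IsLocalRing.ResidueField 𝒪[F])) = 0 := by
    rw [← map_ofNat (PowerSeries.C (R := IsLocalRing.ResidueField 𝒪[F])) 2, ← map_ofNat (IsLocalRing.residue 𝒪[F]) 2,
      residue_two_eq_zero hπ hq u hu, map_zero]
  rw [Nat.cast_add, Nat.cast_mul, Nat.cast_ofNat, h2, zero_mul, zero_add, Nat.cast_one]

omit [IsAdicComplete (Ideal.span {intBase F (LTCoeff.of F π)}) (PowerSeries 𝒪[F])] in
include hπ hq hu in
/-- `(1+X)² − 1 = X(X + 2)` reduces to `X²` in `k⟦X⟧`. [cite: Washington1997, §13.2] -/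
private theorem map_residue_one_add_X_sq_sub_one :
    PowerSeries.map (IsLocalRing.residue 𝒪[F]) ((1 + PowerSeries.X : PowerSeries 𝒪[F]) ^ 2 - 1) = PowerSeries.X ^ 2 := by
  have e : ((1 + PowerSeries.X : PowerSeries 𝒪[F]) ^ 2 - 1) = PowerSeries.X ^ 2 + PowerSeries.C 2 * PowerSeries.X := by
    rw [map_ofNat]; ring
  rw [e, map_add, map_pow, PowerSeries.map_X, map_mul, PowerSeries.map_C, residue_two_eq_zero hπ hq u hu, map_zero, zero_mul, add_zero]

include hε in
/-- ★★ **A PRIME PAIR from two Galois elements with different unramified exponents**: if `(1+X)² − 1 ∣ g₁ − (1+X)^{2b₁}` (the Galois element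
behind `f₁` acts on the first unramified `2`-layer `E_1` through an EVEN power of the Frobenius, e.g. trivially) and `(1+X)² − 1 ∣ g₂ − (1+X)^{2b₂+1}`
(that behind `f₂` through an ODD power), `N₁, N₂` odd, then **`f_{v₁} ∤ f_{v₂}`** for `f_v = t_v·C g − N` — whatever `v₁, v₂ ∈ 𝒪_F^×`.  Proof: the ring map
`Λ → k⟦X⟧` (`T ↦ 0`, coefficients mod `π`; `k = 𝔽₂`) sends `t_v ↦ 1` (§2), `N ↦ 1`, `(1+X)² − 1 ↦ X²`, hence `f_{v₁} ↦ ḡ₁ − 1 ∈ (X²)` and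
`f_{v₂} ↦ ḡ₂ − 1 ≡ X (mod X²)`. With §4 this is the relative primality of de Shalit's auxiliary pair `σ_{𝔞₁} − N𝔞₁`, `σ_{𝔞₂} − N𝔞₂`.
[cite: deShalit1987, Ch. II §4.12 (29)–(33); Ch. III §1.4 (5), Lemma 1.10 (17)] [cite: Washington1997, §13.2] -/
theorem not_dvd_twistScalar_mul_C_sub_natCast (v₁ v₂ : 𝒪[F]ˣ) {g₁ g₂ : PowerSeries 𝒪[F]} {b₁ b₂ : ℕ}
    (hg₁ : ((1 + PowerSeries.X : PowerSeries 𝒪[F]) ^ 2 - 1) ∣ g₁ - (1 + PowerSeries.X) ^ (2 * b₁))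
    (hg₂ : ((1 + PowerSeries.X : PowerSeries 𝒪[F]) ^ 2 - 1) ∣ g₂ - (1 + PowerSeries.X) ^ (2 * b₂ + 1)) {n₁ n₂ : ℕ} (hn₁ : Odd n₁) (hn₂ : Odd n₂) :
    ¬ (colemanDeltaCoinvFun hπ hq (intBase F) u hu γ (eq_zero_of_C_pi_mul_eq_zero_integer hπ) w hγ ε
          (unitTwistₗ hπ hq (intBase F) u hu γ v₁ (TActModule.ofPS _ _ 1)) * PowerSeries.C g₁ - (n₁ : PowerSeries (PowerSeries 𝒪[F])) ∣
       colemanDeltaCoinvFun hπ hq (intBase F) u hu γ (eq_zero_of_C_pi_mul_eq_zero_integer hπ) w hγ ε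
          (unitTwistₗ hπ hq (intBase F) u hu γ v₂ (TActModule.ofPS _ _ 1)) * PowerSeries.C g₂ - (n₂ : PowerSeries (PowerSeries 𝒪[F]))) := by
  intro hdvd
  -- the specialisation `Φ : Λ → k⟦X⟧`, `T ↦ 0`, coefficients mod `π`
  let Φ : PowerSeries (PowerSeries 𝒪[F]) →+* PowerSeries (IsLocalRing.ResidueField 𝒪[F]) :=
    (PowerSeries.map (IsLocalRing.residue 𝒪[F])).comp (PowerSeries.constantCoeff (R := PowerSeries 𝒪[F]))
  have hΦ : ∀ (v : 𝒪[F]ˣ) (g : PowerSeries 𝒪[F]) {n : ℕ}, Odd n →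
      Φ (colemanDeltaCoinvFun hπ hq (intBase F) u hu γ (eq_zero_of_C_pi_mul_eq_zero_integer hπ) w hγ ε
          (unitTwistₗ hπ hq (intBase F) u hu γ v (TActModule.ofPS _ _ 1)) * PowerSeries.C g - (n : PowerSeries (PowerSeries 𝒪[F]))) =
        PowerSeries.map (IsLocalRing.residue 𝒪[F]) g - 1 := by
    intro v g n hn
    rw [map_sub, map_mul, map_natCast, natCast_residue_powerSeries_eq_one hπ hq u hu hn]
    simp only [Φ, RingHom.comp_apply, PowerSeries.constantCoeff_C]
    rw [map_residue_constantCoeff_twistScalar hπ hq u hu γ w hγ ε hε v, one_mul]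
  -- `(1+X)² − 1 ∣ g₁ − 1` and `(1+X)² − 1 ∣ g₂ − (1+X)`
  have hsq : ((1 + PowerSeries.X : PowerSeries 𝒪[F]) ^ 2 - 1) ∣ ((1 + PowerSeries.X) ^ 2) ^ b₁ - 1 := by
    simpa only [one_pow] using sub_dvd_pow_sub_pow ((1 + PowerSeries.X : PowerSeries 𝒪[F]) ^ 2) 1 b₁
  have hg₁' : ((1 + PowerSeries.X : PowerSeries 𝒪[F]) ^ 2 - 1) ∣ g₁ - 1 := by
    have e : g₁ - 1 = (g₁ - (1 + PowerSeries.X) ^ (2 * b₁)) + (((1 + PowerSeries.X) ^ 2) ^ b₁ - 1) := by rw [pow_mul]; ring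
    rw [e]; exact dvd_add hg₁ hsq
  have hg₂' : ((1 + PowerSeries.X : PowerSeries 𝒪[F]) ^ 2 - 1) ∣ g₂ - (1 + PowerSeries.X) := by
    have hsq₂ : ((1 + PowerSeries.X : PowerSeries 𝒪[F]) ^ 2 - 1) ∣ ((1 + PowerSeries.X) ^ 2) ^ b₂ - 1 := by
      simpa only [one_pow] using sub_dvd_pow_sub_pow ((1 + PowerSeries.X : PowerSeries 𝒪[F]) ^ 2) 1 b₂
    have e : g₂ - (1 + PowerSeries.X) = (g₂ - (1 + PowerSeries.X) ^ (2 * b₂ + 1)) + (1 + PowerSeries.X) * (((1 + PowerSeries.X) ^ 2) ^ b₂ - 1) := by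
      rw [pow_succ, pow_mul]; ring
    rw [e]; exact dvd_add hg₂ (hsq₂.mul_left _)
  -- reduce: `X² ∣ ḡ₁ − 1 = Φ f₁ ∣ Φ f₂ = ḡ₂ − 1` and `X² ∣ ḡ₂ − 1 − X`
  have h1 : (PowerSeries.X : PowerSeries (IsLocalRing.ResidueField 𝒪[F])) ^ 2 ∣ PowerSeries.map (IsLocalRing.residue 𝒪[F]) g₁ - 1 := by
    have h := map_dvd (PowerSeries.map (IsLocalRing.residue 𝒪[F])) hg₁'
    rwa [map_residue_one_add_X_sq_sub_one hπ hq u hu, map_sub, map_one] at h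
  have h2 : (PowerSeries.X : PowerSeries (IsLocalRing.ResidueField 𝒪[F])) ^ 2 ∣
      PowerSeries.map (IsLocalRing.residue 𝒪[F]) g₂ - 1 - PowerSeries.X := by
    have h := map_dvd (PowerSeries.map (IsLocalRing.residue 𝒪[F])) hg₂'
    rwa [map_residue_one_add_X_sq_sub_one hπ hq u hu, map_sub, map_add, map_one, PowerSeries.map_X, ← sub_sub] at h
  have h12 : PowerSeries.map (IsLocalRing.residue 𝒪[F]) g₁ - 1 ∣ PowerSeries.map (IsLocalRing.residue 𝒪[F]) g₂ - 1 := by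
    have h := map_dvd Φ hdvd
    rwa [hΦ v₁ g₁ hn₁, hΦ v₂ g₂ hn₂] at h
  have hX : (PowerSeries.X : PowerSeries (IsLocalRing.ResidueField 𝒪[F])) ^ 2 ∣ PowerSeries.X := by
    have h := dvd_sub (h1.trans h12) h2
    rwa [sub_sub_cancel] at h
  rw [PowerSeries.X_pow_dvd_iff] at hX
  have h10 := hX 1 (by norm_num)
  rw [PowerSeries.coeff_one_X] at h10
  exact one_ne_zero h10

include hε in
/-- ★★ **`f_v` is prime for every `v ≡ γ (mod π³)`** (`g(0) = 1`, `N` odd): `vγ⁻¹ ∈ U_3` is a square `s²` (`exists_isUnit_sq_eq`), so `v = γs²`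
and §3–§4 apply.  The form in which the Artin symbol of an auxiliary ideal `𝔞₁` with `σ_{𝔞₁} ≡ σ̃_γ` on `K(𝔪v³)` is used.
[cite: deShalit1987, Ch. II §4.12 (32); Ch. III §1.4 (5)] [cite: Serre1973CourseArithmetic, Ch. II §3.3] -/
theorem prime_twistScalar_mul_C_sub_natCast_of_dvd_sub_gen {v : 𝒪[F]ˣ} (hv : π ^ 3 ∣ (v : 𝒪[F]) - γ)
    {g : PowerSeries 𝒪[F]} (hg : PowerSeries.constantCoeff g = 1) {n : ℕ} (hn : Odd n) :
    Prime (colemanDeltaCoinvFun hπ hq (intBase F) u hu γ (eq_zero_of_C_pi_mul_eq_zero_integer hπ) w hγ ε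
        (unitTwistₗ hπ hq (intBase F) u hu γ v (TActModule.ofPS _ _ 1)) * PowerSeries.C g - (n : PowerSeries (PowerSeries 𝒪[F]))) := by
  -- `2 = π·t`
  have ht : (2 : 𝒪[F]) = π * ((Units.map (LTCoeff.of F).symm.toRingHom.toMonoidHom u⁻¹ : 𝒪[F]ˣ) : 𝒪[F]) := by
    have h := congrArg (LTCoeff.of F).symm (two_eq_of_mul_inv (π := π) hq u hu)
    rw [map_ofNat, map_mul, RingEquiv.symm_apply_apply] at h
    exact h
  -- `vγ⁻¹ = s²`
  have hc : π ^ 3 ∣ ((v * γ⁻¹ : 𝒪[F]ˣ) : 𝒪[F]) - 1 := by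
    have e : ((v * γ⁻¹ : 𝒪[F]ˣ) : 𝒪[F]) - 1 = ((v : 𝒪[F]) - γ) * ((γ⁻¹ : 𝒪[F]ˣ) : 𝒪[F]) := by
      rw [sub_mul, Units.val_mul, Units.mul_inv]
    rw [e]; exact hv.mul_right _
  obtain ⟨x, hx, hx2⟩ := exists_isUnit_sq_eq hπ ht hc
  have hvs : v = γ * (hx.unit * hx.unit) := by
    have e : v * γ⁻¹ = hx.unit * hx.unit := Units.ext (by rw [Units.val_mul (hx.unit), IsUnit.unit_spec, ← sq, hx2])
    rw [← e, mul_comm, inv_mul_cancel_right]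
  rw [hvs]
  exact prime_twistScalar_mul_C_sub_natCast hπ hq u hu γ w hγ ε hε (isUnit_coeff_one_twistScalar_gen_mul_sq hπ hq u hu γ w hγ ε hε hx.unit) hg hn

end TwistScalarDegreeOne

end Literature.NumberTheory.GaloisRepresentations

end
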